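import Mathlib.FieldTheory.PrimitiveElement
import Mathlib.FieldTheory.Perfect
import Mathlib.RingTheory.Algebraic.Integral
import Literature.NumberTheory.Transcendental.AnalytificationProperProofs
import Literature.NumberTheory.Transcendental.HypersurfaceCover
import HarnessLib

/-!
# Irreducible affine varieties over `ℂ` are connected: proof of
`Literature.NumberTheory.Transcendental.isConnected_zeroLocus_of_isPrime`

This file discharges the named fact `Literature.NumberTheory.Transcendental.isConnected_zeroLocus_of_isPrime` of
`Literature/NumberTheory/Transcendental/ZeroLocusConnected.lean`: for a prime ideal
`𝔭 ⊆ ℂ[x₁, …, xₙ]`, the zero set `V(𝔭) ⊆ ℂⁿ` is connected in the classical topology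
(Shafarevich, *Basic Algebraic Geometry 2*, Book 3, Ch. VII §2, Theorem 7.1, affine case; the
irreducible affine case of SGA1 XII Prop. 2.4). The analytic core — connectedness of an unramified
piece `{(z, t) | g(z) ≠ 0, F(z, t) = 0}` of an irreducible hypersurface `F(z, T) = 0`,
`F ∈ ℂ[z₁, …, z_r][T]` monic — is `HypersurfaceCover.isConnected`
(`Literature/NumberTheory/Transcendental/HypersurfaceCover.lean`, Shafarevich VII §2.4). Here we
supply the algebra and the density argument of Shafarevich's *second proof* (VII §2.3) and of
Mumford, *Algebraic Geometry I: Complex Projective Varieties*, (2.33) (proof by Stolzenberg),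
for `X = Spec A`, `A = ℂ[x₁, …, xₙ]/𝔭` presented by `q : ℂ[x₁, …, xₙ] ↠ A`, with complex points
`pts q = V(ker q) ⊆ ℂⁿ`:

* points and characters (`ZeroLocusConnected.chi`, `fn`): a point `x ∈ pts q` is the character
  `a ↦ a(x)` of `A`; a Noether normalisation `B = ℂ[z₁, …, z_r] ⊆ A` (`A` finite over `B`,
  Mathlib `exists_integral_inj_algHom_of_quotient`) gives the finite projection
  `π = proj : pts q → ℂʳ`;
* `exists_mem_pts_over`: for `θ ∈ A` with minimal polynomial `F ∈ B[T]` (`B` is integrally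
  closed, so `B[T]/(F) ≅ B[θ] ⊆ A`), every zero `(z, t)` of `F` lifts to a point `x ∈ pts q`
  with `π(x) = z`, `θ(x) = t`: the character of `B[θ]` defined by `(z, t)` extends to `A` along
  the integral inclusion (`Literature.NumberTheory.Transcendental.AlgHomClosure.exists_ringHom_comp_eq_of_isIntegral`: lying over +
  algebraic closedness of `ℂ`), and `ℂ`-linear characters of `A` are points;
* `subset_closure_setOf_eval_ne_zero`: **`X_g = {x | g(π(x)) ≠ 0}` is dense in `X = pts q`**
  for `g ∈ B ∖ 0` — the case `f = g ∈ B` of the density of `D(f)(ℂ)` in `X(ℂ)` (Mumford (2.33);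
  SGA1 XII Prop. 2.2; Serre GAGA §2 n°7 Prop. 5), proved in the tree as
  `Literature.NumberTheory.Transcendental.AlgHomClosure.mem_closure_setOf_le_ker_aeval`
  (`Literature/NumberTheory/Transcendental/AnalytificationProperProofs.lean`) and only
  transported here to the coordinates `pts q`;
* `exists_primitive`, `exists_separable`: a primitive element `θ ∈ A` of `Frac A / Frac B` and
  `c ∈ B ∖ 0` with `c · x̄ᵢ ∈ B[θ]` for all coordinates, and `d ∈ B ∖ 0` with `F(z, ·)`
  separable on `{d ≠ 0}` (Shafarevich VII §2.3, the Lemma: over `{cd ≠ 0}` the variety is an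
  unramified hypersurface piece);
* `isConnected_pts`: `X_{cd}` is the continuous image of the connected hypersurface piece, and is
  dense, so `X` is connected; `isConnected_zeroLocus_of_isPrime_holds` transports this to
  `V(𝔭) = pts (ℂ[x]/𝔭)`.

## References

* I. R. Shafarevich, *Basic Algebraic Geometry 2*, Springer 1994, Book 3, Ch. VII §2.3, Lemma and
  second proof of Thm. 7.1.
* D. Mumford, *Algebraic Geometry I: Complex Projective Varieties*, Springer 1976/1981, (2.32),
  (2.33), (4.16).
* A. Grothendieck, M. Raynaud, *SGA 1*, Exp. XII, Prop. 2.4.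
-/

noncomputable section

open Filter Topology Set

namespace Literature.NumberTheory.Transcendental

namespace ZeroLocusConnected

open HypersurfaceCover (spec)

variable {n r : ℕ} {A : Type*} [CommRing A] [Algebra ℂ A]
  (q : MvPolynomial (Fin n) ℂ →ₐ[ℂ] A) (hq : Function.Surjective q)

/-! ### Points of an affine `ℂ`-algebra in coordinates, and their characters -/

/-- The complex points of `Spec A` in the coordinates of a presentation
`q : ℂ[x₁, …, xₙ] ↠ A`: the common zeros of `ker q`. [folklore] -/
def pts : Set (Fin n → ℂ) := {x | ∀ p, q p = 0 → MvPolynomial.eval x p = 0}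

variable {q} in
/-- `x ∈ pts q ↔ p(x) = 0` for all `p ∈ ker q`. [folklore] -/
theorem mem_pts {x : Fin n → ℂ} : x ∈ pts q ↔ ∀ p, q p = 0 → MvPolynomial.eval x p = 0 := Iff.rfl

/-- `pts q` is closed in `ℂⁿ`. [folklore] -/
theorem isClosed_pts : IsClosed (pts q) := by
  have : pts q = ⋂ p ∈ {p : MvPolynomial (Fin n) ℂ | q p = 0}, (fun x ↦ MvPolynomial.eval x p) ⁻¹' {0} := by
    ext x
    simp [mem_pts]
  rw [this]
  exact isClosed_biInter fun p _ ↦ isClosed_singleton.preimage (MvPolynomial.continuous_eval p)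

/-- A polynomial representative of `a ∈ A` (a section of `q`). [folklore] -/
def repr (a : A) : MvPolynomial (Fin n) ℂ := Function.surjInv hq a

/-- `repr` is a section of `q`. [folklore] -/
theorem q_repr (a : A) : q (repr q hq a) = a := Function.surjInv_eq hq a

/-- `a ∈ A` as a (polynomial, hence continuous) function on `ℂⁿ`; on `pts q` it is the value of
`a` at the point. [folklore] -/
def fn (a : A) (x : Fin n → ℂ) : ℂ := MvPolynomial.eval x (repr q hq a)

/-- `fn q hq a` is continuous (a polynomial function). [folklore] -/
theorem continuous_fn (a : A) : Continuous (fn q hq a) := MvPolynomial.continuous_eval _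

variable {q}

/-- Evaluation at a point of `pts q` kills `ker q`. [folklore] -/
theorem ker_le_ker_eval {x : Fin n → ℂ} (hx : x ∈ pts q) :
    RingHom.ker q.toRingHom ≤ RingHom.ker (MvPolynomial.eval x) :=
  fun p hp ↦ RingHom.mem_ker.2 (hx p (RingHom.mem_ker.1 hp))

variable (q)

/-- The character `A → ℂ` «evaluation at the point `x ∈ pts q`». [folklore] -/
def chi {x : Fin n → ℂ} (hx : x ∈ pts q) : A →+* ℂ :=
  q.toRingHom.liftOfSurjective hq ⟨MvPolynomial.eval x, ker_le_ker_eval hx⟩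

/-- The character of `x` on `q p` is `p(x)`. [folklore] -/
theorem chi_q {x : Fin n → ℂ} (hx : x ∈ pts q) (p : MvPolynomial (Fin n) ℂ) :
    chi q hq hx (q p) = MvPolynomial.eval x p :=
  q.toRingHom.liftOfSurjective_comp_apply hq ⟨MvPolynomial.eval x, ker_le_ker_eval hx⟩ p

/-- The character of `x` is `a ↦ fn q hq a x`. [folklore] -/
theorem chi_eq_fn {x : Fin n → ℂ} (hx : x ∈ pts q) (a : A) : chi q hq hx a = fn q hq a x := by
  conv_lhs => rw [← q_repr q hq a]
  exact chi_q q hq hx _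

/-- `fn q hq (q p) x = p(x)` on `pts q`. [folklore] -/
theorem fn_q {x : Fin n → ℂ} (hx : x ∈ pts q) (p : MvPolynomial (Fin n) ℂ) :
    fn q hq (q p) x = MvPolynomial.eval x p := by
  rw [← chi_eq_fn q hq hx, chi_q]

/-- Characters are `ℂ`-linear. [folklore] -/
theorem chi_algebraMap_complex {x : Fin n → ℂ} (hx : x ∈ pts q) (c : ℂ) :
    chi q hq hx (algebraMap ℂ A c) = c := by
  rw [← q.commutes c, chi_q, MvPolynomial.algebraMap_eq, MvPolynomial.eval_C]

/-- Constants take constant values. [folklore] -/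
theorem fn_algebraMap_complex {x : Fin n → ℂ} (hx : x ∈ pts q) (c : ℂ) :
    fn q hq (algebraMap ℂ A c) x = c := by
  rw [← chi_eq_fn q hq hx, chi_algebraMap_complex]

/-- `fn` is multiplicative on `pts q`. [folklore] -/
theorem fn_mul {x : Fin n → ℂ} (hx : x ∈ pts q) (a b : A) :
    fn q hq (a * b) x = fn q hq a x * fn q hq b x := by
  simp only [← chi_eq_fn q hq hx, map_mul]


/-! ### Noether coordinates -/

section Noether

variable [Algebra (MvPolynomial (Fin r) ℂ) A]

/-- The finite projection `π : pts q → ℂʳ` given by a Noether normalisation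
`ℂ[z₁, …, z_r] ⊆ A`, as a polynomial map `ℂⁿ → ℂʳ`. [folklore] -/
def proj (x : Fin n → ℂ) : Fin r → ℂ :=
  fun j ↦ fn q hq (algebraMap (MvPolynomial (Fin r) ℂ) A (MvPolynomial.X j)) x

/-- The projection `proj` is continuous. [folklore] -/
theorem continuous_proj : Continuous (proj (r := r) q hq) :=
  continuous_pi fun _ ↦ continuous_fn q hq _

variable [IsScalarTower ℂ (MvPolynomial (Fin r) ℂ) A]

/-- The character of `x` restricted to `B = ℂ[z₁, …, z_r]` is evaluation at `π(x)`.
[folklore] -/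
theorem chi_comp_algebraMap {x : Fin n → ℂ} (hx : x ∈ pts q) :
    (chi q hq hx).comp (algebraMap (MvPolynomial (Fin r) ℂ) A) = MvPolynomial.eval (proj q hq x) := by
  refine MvPolynomial.ringHom_ext (fun c ↦ ?_) (fun j ↦ ?_)
  · rw [RingHom.comp_apply, MvPolynomial.eval_C, ← MvPolynomial.algebraMap_eq,
      ← IsScalarTower.algebraMap_apply, chi_algebraMap_complex]
  · rw [RingHom.comp_apply, MvPolynomial.eval_X, chi_eq_fn]
    rfl

/-- `b(x) = b(π(x))` for `b ∈ B`, character form. [folklore] -/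
theorem chi_algebraMap {x : Fin n → ℂ} (hx : x ∈ pts q) (b : MvPolynomial (Fin r) ℂ) :
    chi q hq hx (algebraMap (MvPolynomial (Fin r) ℂ) A b) = MvPolynomial.eval (proj q hq x) b := by
  rw [← RingHom.comp_apply, chi_comp_algebraMap]

/-- `b(x) = b(π(x))` for `b ∈ B`. [folklore] -/
theorem fn_algebraMap {x : Fin n → ℂ} (hx : x ∈ pts q) (b : MvPolynomial (Fin r) ℂ) :
    fn q hq (algebraMap (MvPolynomial (Fin r) ℂ) A b) x = MvPolynomial.eval (proj q hq x) b := by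
  rw [← chi_eq_fn q hq hx, chi_algebraMap]

/-- Compatibility of characters with `B[T] → A`, `T ↦ θ`: the value of `P(θ)` at a point `x`
is `P(π(x), θ(x))`. [folklore] -/
theorem chi_aeval {x : Fin n → ℂ} (hx : x ∈ pts q) (θ : A)
    (P : Polynomial (MvPolynomial (Fin r) ℂ)) :
    chi q hq hx (Polynomial.aeval θ P) = (spec P (proj q hq x)).eval (fn q hq θ x) := by
  rw [Polynomial.aeval_def, Polynomial.hom_eval₂, chi_comp_algebraMap, chi_eq_fn,
    Polynomial.eval_map]

/-- The value of `P(θ)` at `x ∈ pts q` is `P(π(x), θ(x))`. [folklore] -/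
theorem fn_aeval {x : Fin n → ℂ} (hx : x ∈ pts q) (θ : A)
    (P : Polynomial (MvPolynomial (Fin r) ℂ)) :
    fn q hq (Polynomial.aeval θ P) x = (spec P (proj q hq x)).eval (fn q hq θ x) := by
  rw [← chi_eq_fn q hq hx, chi_aeval]

/-- In particular `F(π(x), θ(x)) = 0` on `pts q` for the minimal polynomial `F` of `θ`.
[folklore] -/
theorem eval_spec_minpoly {x : Fin n → ℂ} (hx : x ∈ pts q) (θ : A) :
    (spec (minpoly (MvPolynomial (Fin r) ℂ) θ) (proj q hq x)).eval (fn q hq θ x) = 0 := by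
  rw [← fn_aeval q hq hx, minpoly.aeval, ← chi_eq_fn q hq hx, map_zero]

/-! ### Lifting points of the hypersurface `F(z, t) = 0` -/

variable [IsDomain A] [Algebra.IsIntegral (MvPolynomial (Fin r) ℂ) A]
  [FaithfulSMul (MvPolynomial (Fin r) ℂ) A]

/-- **Surjectivity of `X → V(F)`.** Let `θ ∈ A` and let `F ∈ B[T]` be its minimal polynomial
over the Noether subring `B = ℂ[z₁, …, z_r]` (integrally closed, so `B[T]/(F) ≅ B[θ]`, Mathlib
`minpoly.equivAdjoin`). Every solution `(z, t)` of `F(z, t) = 0` lifts to a point `x` of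
`X = pts q` with `π(x) = z` and `θ(x) = t`: the character of `B[θ]` defined by `(z, t)` extends
along the integral inclusion `B[θ] ⊆ A` to a character `Φ` of `A`
(`AlgHomClosure.exists_ringHom_comp_eq_of_isIntegral`), which is `ℂ`-linear, so that `Φ ∘ q` is
evaluation at the point `x = (Φ(x̄ᵢ))ᵢ ∈ pts q`.
[Mumford1981 (2.33) Step III «Lift bᵢ to any cᵢ ∈ X»; Shafarevich1994 VII §2.3] [folklore] -/
theorem exists_mem_pts_over (θ : A) {z : Fin r → ℂ} {t : ℂ}
    (h : (spec (minpoly (MvPolynomial (Fin r) ℂ) θ) z).eval t = 0) :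
    ∃ x ∈ pts q, proj q hq x = z ∧ fn q hq θ x = t := by
  classical
  have hθ : IsIntegral (MvPolynomial (Fin r) ℂ) θ := Algebra.IsIntegral.isIntegral θ
  set F := minpoly (MvPolynomial (Fin r) ℂ) θ with hF
  have h' : F.eval₂ (MvPolynomial.eval z) t = 0 := by rwa [← Polynomial.eval_map]
  -- the character of `B[T]/(F)` defined by `(z, t)`, and `j : B[T]/(F) ≅ B[θ] ⊆ A`
  let ψ₀ : AdjoinRoot F →+* ℂ := AdjoinRoot.lift (MvPolynomial.eval z) t h'
  let R : Subalgebra (MvPolynomial (Fin r) ℂ) A := Algebra.adjoin (MvPolynomial (Fin r) ℂ) {θ}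
  let e : AdjoinRoot F ≃ₐ[MvPolynomial (Fin r) ℂ] R := minpoly.equivAdjoin hθ
  let j : AdjoinRoot F →ₐ[MvPolynomial (Fin r) ℂ] A := R.val.comp e.toAlgHom
  have hj_inj : Function.Injective j := Subtype.val_injective.comp e.injective
  have hj_of : ∀ b, j (AdjoinRoot.of F b) = algebraMap _ A b := fun b ↦ by
    rw [← AdjoinRoot.algebraMap_eq]
    exact j.commutes b
  have hj_root : j (AdjoinRoot.root F) = θ := by
    change ((e (AdjoinRoot.root F) : R) : A) = θ
    exact AdjoinRoot.Minpoly.coe_toAdjoin_mk_X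
  -- extend `ψ₀` along the integral injection `j` to `Φ : A → ℂ`
  have hj_int : j.toRingHom.IsIntegral := by
    refine RingHom.IsIntegral.tower_top (AdjoinRoot.of F) j.toRingHom fun a ↦ ?_
    have hcomp : j.toRingHom.comp (AdjoinRoot.of F) = algebraMap (MvPolynomial (Fin r) ℂ) A :=
      RingHom.ext hj_of
    rw [hcomp]
    exact Algebra.IsIntegral.isIntegral a
  have hker : RingHom.ker j.toRingHom ≤ RingHom.ker ψ₀ := by
    rw [(RingHom.injective_iff_ker_eq_bot j.toRingHom).mp hj_inj]
    exact bot_le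
  obtain ⟨Φ, hΦ⟩ := AlgHomClosure.exists_ringHom_comp_eq_of_isIntegral j.toRingHom hj_int ψ₀ hker
  have hΦj : ∀ w, Φ (j w) = ψ₀ w := fun w ↦ by
    rw [← hΦ]
    rfl
  have hΦalg : ∀ b, Φ (algebraMap (MvPolynomial (Fin r) ℂ) A b) = MvPolynomial.eval z b :=
    fun b ↦ by rw [← hj_of, hΦj, AdjoinRoot.lift_of]
  have hΦC : ∀ c : ℂ, Φ (algebraMap ℂ A c) = c := fun c ↦ by
    rw [IsScalarTower.algebraMap_apply ℂ (MvPolynomial (Fin r) ℂ) A, hΦalg,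
      MvPolynomial.algebraMap_eq, MvPolynomial.eval_C]
  -- `Φ` is `ℂ`-linear, so `Φ ∘ q` is evaluation at the point `x = (Φ(x̄ᵢ))ᵢ`
  set x : Fin n → ℂ := fun i ↦ Φ (q (MvPolynomial.X i)) with hx
  have hΦq : Φ.comp q.toRingHom = MvPolynomial.eval x := by
    refine MvPolynomial.ringHom_ext (fun c ↦ ?_) (fun i ↦ ?_)
    · rw [RingHom.comp_apply, MvPolynomial.eval_C, AlgHom.toRingHom_eq_coe, AlgHom.coe_toRingHom,
        ← MvPolynomial.algebraMap_eq, q.commutes, hΦC]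
    · rw [RingHom.comp_apply, MvPolynomial.eval_X]
      rfl
  have hxpts : x ∈ pts q := fun p hp ↦ by
    rw [← hΦq, RingHom.comp_apply, AlgHom.toRingHom_eq_coe, AlgHom.coe_toRingHom, hp, map_zero]
  have hfn : ∀ a, fn q hq a x = Φ a := fun a ↦ by
    rw [← chi_eq_fn q hq hxpts]
    obtain ⟨p, rfl⟩ := hq a
    rw [chi_q, ← hΦq]
    rfl
  refine ⟨x, hxpts, funext fun i ↦ ?_, ?_⟩
  · change fn q hq (algebraMap _ A (MvPolynomial.X i)) x = z i
    rw [hfn, hΦalg, MvPolynomial.eval_X]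
  · rw [hfn, ← hj_root, hΦj, AdjoinRoot.lift_root]

/-! ### Density of `X_g = {x ∈ X | g(π(x)) ≠ 0}` in `X` -/

omit [Algebra.IsIntegral (MvPolynomial (Fin r) ℂ) A] in
/-- **`X_g` is dense in `X` for the classical topology** (`g ∈ B`, `g ≠ 0`): every `c ∈ X` is a
limit of points `x ∈ X` with `g(π(x)) ≠ 0`. This is the case `f = g ∈ B ⊆ A` of the density
of `D(f)(ℂ)` in `Spec(A)(ℂ)` (Mumford (2.33), proof by Stolzenberg; SGA1 XII Prop. 2.2; Serre,
GAGA §2 n°7 Prop. 5), available in the tree in the coordinate form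
`AlgHomClosure.mem_closure_setOf_le_ker_aeval` (for the prime `ker q` and `f` a representative
of `g`); here it is only transported to `pts q`. [cite: Mumford1981, (2.33)]
[cite: SGA1, Exp. XII Prop. 2.2] -/
theorem subset_closure_setOf_eval_ne_zero {g : MvPolynomial (Fin r) ℂ} (hg : g ≠ 0) :
    pts q ⊆ closure {x ∈ pts q | MvPolynomial.eval (proj (r := r) q hq x) g ≠ 0} := by
  classical
  intro c hc
  haveI : (RingHom.ker q.toRingHom).IsPrime := RingHom.ker_isPrime _
  -- a representative `f` of `g ∈ A`; `f ∉ ker q` since `B → A` is injective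
  have hf : repr q hq (algebraMap (MvPolynomial (Fin r) ℂ) A g) ∉ RingHom.ker q.toRingHom := by
    rw [RingHom.mem_ker, AlgHom.toRingHom_eq_coe, AlgHom.coe_toRingHom, q_repr]
    exact (map_ne_zero_iff _ (FaithfulSMul.algebraMap_injective _ _)).mpr hg
  -- `pts q` is the set of `w` with `ker q ≤ ker ev_w`
  have hpts : ∀ w : Fin n → ℂ, RingHom.ker q.toRingHom ≤
      RingHom.ker (MvPolynomial.aeval w : MvPolynomial (Fin n) ℂ →ₐ[ℂ] ℂ) ↔ w ∈ pts q := by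
    intro w
    refine ⟨fun hw p hp ↦ ?_, fun hw p hp ↦ ?_⟩
    · have := hw ((RingHom.mem_ker (f := q.toRingHom)).mpr hp)
      rwa [RingHom.mem_ker] at this
    · rw [RingHom.mem_ker]
      exact hw p ((RingHom.mem_ker (f := q.toRingHom)).mp hp)
  have key := AlgHomClosure.mem_closure_setOf_le_ker_aeval hf ((hpts c).mpr hc)
  refine closure_mono (fun w hw ↦ ?_) key
  have hwpts : w ∈ pts q := (hpts w).mp hw.1
  refine ⟨hwpts, ?_⟩
  have h2 : fn q hq (algebraMap (MvPolynomial (Fin r) ℂ) A g) w ≠ 0 := hw.2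
  rwa [fn_algebraMap q hq hwpts] at h2

/-! ### A primitive element of `Frac A / Frac B` inside `A`, with cleared denominators -/

include hq in
/-- **Primitive element with denominators cleared** (the algebraic input of Shafarevich's Lemma
of §2.3: «`U` is isomorphic to a hypersurface `V(F)`» over `{c ≠ 0}`). There are `θ ∈ A` and
`c ∈ B = ℂ[z₁, …, z_r]`, `c ≠ 0`, such that `c · x̄ᵢ ∈ B[θ]` for every coordinate function
`x̄ᵢ = q(Xᵢ)`: a primitive element of the finite separable extension `Frac A / Frac B` (Mathlib
`Field.exists_primitive_element`) multiplied into `A`, and the denominators of the `x̄ᵢ` as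
`Frac B`-polynomials in `θ` cleared. [Shafarevich1994 VII §2.3, Lemma] [folklore] -/
theorem exists_primitive :
    ∃ θ : A, ∃ c : MvPolynomial (Fin r) ℂ, c ≠ 0 ∧ ∀ i : Fin n,
      ∃ P : Polynomial (MvPolynomial (Fin r) ℂ),
        Polynomial.aeval θ P = algebraMap (MvPolynomial (Fin r) ℂ) A c * q (MvPolynomial.X i) := by
  classical
  let K := FractionRing (MvPolynomial (Fin r) ℂ)
  let L := FractionRing A
  letI : Algebra K L := FractionRing.liftAlgebra (MvPolynomial (Fin r) ℂ) L
  haveI : IsScalarTower (MvPolynomial (Fin r) ℂ) K L :=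
    FractionRing.isScalarTower_liftAlgebra _ _
  haveI : Module.Finite (MvPolynomial (Fin r) ℂ) A := by
    haveI : Algebra.FiniteType ℂ A := Algebra.FiniteType.of_surjective q hq
    haveI : Algebra.FiniteType (MvPolynomial (Fin r) ℂ) A :=
      Algebra.FiniteType.of_restrictScalars_finiteType ℂ _ _
    exact Algebra.IsIntegral.finite
  haveI : FiniteDimensional K L := inferInstance
  haveI : Algebra.IsSeparable K L := inferInstance
  obtain ⟨α, hα⟩ := Field.exists_primitive_element K L
  -- move `α = a / s` into `A`: `s s' = b ∈ B ∖ 0`, `θ := a s'`, `θ = b α`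
  obtain ⟨a, s, hs, hαeq⟩ := IsFractionRing.div_surjective (A := A) α
  have hs0 : s ≠ 0 := nonZeroDivisors.ne_zero hs
  have hsint : IsIntegral (MvPolynomial (Fin r) ℂ) s := Algebra.IsIntegral.isIntegral s
  set ms := minpoly (MvPolynomial (Fin r) ℂ) s with hms
  have hsL : algebraMap A L s ≠ 0 :=
    (map_ne_zero_iff _ (IsFractionRing.injective A L)).mpr hs0
  have hb : ms.coeff 0 ≠ 0 := by
    intro h0
    have hint : IsIntegral K (algebraMap A L s) := (hsint.algebraMap (B := L)).tower_top
    have h1 := minpoly.coeff_zero_ne_zero hint hsL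
    rw [minpoly.isIntegrallyClosed_eq_field_fractions K L hsint, Polynomial.coeff_map, ← hms, h0,
      map_zero] at h1
    exact h1 rfl
  set s' : A := -(Polynomial.aeval s ms.divX) with hs'
  have hrel : s * s' = algebraMap _ A (ms.coeff 0) := by
    have h0 : Polynomial.aeval s ms = 0 := minpoly.aeval _ s
    rw [← ms.divX_mul_X_add, map_add, map_mul, Polynomial.aeval_X, Polynomial.aeval_C] at h0
    rw [hs']
    linear_combination -h0
  set θ : A := a * s' with hθdef
  have hθL : algebraMap A L θ =
      algebraMap K L (algebraMap (MvPolynomial (Fin r) ℂ) K (ms.coeff 0)) * α := by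
    rw [← IsScalarTower.algebraMap_apply (MvPolynomial (Fin r) ℂ) K L,
      IsScalarTower.algebraMap_apply (MvPolynomial (Fin r) ℂ) A L, ← hrel, ← hαeq, hθdef, map_mul,
      map_mul]
    have e : algebraMap A L a / algebraMap A L s * algebraMap A L s = algebraMap A L a :=
      div_mul_cancel₀ _ hsL
    linear_combination (-(algebraMap A L s')) * e
  have hbK : algebraMap (MvPolynomial (Fin r) ℂ) K (ms.coeff 0) ≠ 0 :=
    (map_ne_zero_iff _ (IsFractionRing.injective _ _)).mpr hb
  have hθtop : IntermediateField.adjoin K {algebraMap A L θ} = ⊤ := by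
    rw [eq_top_iff, ← hα]
    refine IntermediateField.adjoin_simple_le_iff.mpr ?_
    have hαθ : α = (algebraMap _ K (ms.coeff 0))⁻¹ • algebraMap A L θ := by
      rw [hθL, Algebra.smul_def, map_inv₀, ← mul_assoc,
        inv_mul_cancel₀ ((_root_.map_ne_zero _).mpr hbK), one_mul]
    rw [hαθ]
    exact IntermediateField.smul_mem _ (IntermediateField.mem_adjoin_simple_self K _)
  -- each `x̄ᵢ` is a `Frac B`-polynomial in `θ`; clear denominators
  have hmem : ∀ i : Fin n, ∃ P : Polynomial (MvPolynomial (Fin r) ℂ), ∃ d : MvPolynomial (Fin r) ℂ,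
      d ≠ 0 ∧ Polynomial.aeval θ P = algebraMap _ A d * q (MvPolynomial.X i) := fun i ↦ by
    have hy : algebraMap A L (q (MvPolynomial.X i)) ∈
        IntermediateField.adjoin K {algebraMap A L θ} := by
      rw [hθtop]
      exact IntermediateField.mem_top
    rw [← IntermediateField.mem_toSubalgebra, IntermediateField.adjoin_simple_toSubalgebra_of_isAlgebraic
      (Algebra.IsAlgebraic.isAlgebraic _), Algebra.adjoin_singleton_eq_range_aeval,
      AlgHom.mem_range] at hy
    obtain ⟨p, hp⟩ := hy
    obtain ⟨d, hd, hdp⟩ :=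
      IsLocalization.integerNormalization_spec (nonZeroDivisors (MvPolynomial (Fin r) ℂ)) p
    refine ⟨IsLocalization.integerNormalization (nonZeroDivisors (MvPolynomial (Fin r) ℂ)) p, d,
      nonZeroDivisors.ne_zero hd, IsFractionRing.injective A L ?_⟩
    rw [← Polynomial.aeval_algebraMap_apply, ← Polynomial.aeval_map_algebraMap K, hdp,
      ← algebraMap_smul K d p, map_smul, hp, map_mul,
      ← IsScalarTower.algebraMap_apply (MvPolynomial (Fin r) ℂ) A L,
      IsScalarTower.algebraMap_apply (MvPolynomial (Fin r) ℂ) K L, Algebra.smul_def]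
  choose P d hd hP using hmem
  refine ⟨θ, ∏ i, d i, Finset.prod_ne_zero_iff.mpr fun i _ ↦ hd i, fun i ↦
    ⟨Polynomial.C (∏ j ∈ Finset.univ.erase i, d j) * P i, ?_⟩⟩
  rw [map_mul, Polynomial.aeval_C, hP, ← mul_assoc, ← map_mul, Finset.prod_erase_mul _ _
    (Finset.mem_univ i)]

omit [Algebra ℂ A] [IsScalarTower ℂ (MvPolynomial (Fin r) ℂ) A] in
/-- **Generic separability.** For `θ ∈ A` with minimal polynomial `F ∈ B[T]` over
`B = ℂ[z₁, …, z_r]` there is `d ∈ B`, `d ≠ 0`, such that `F(z, ·)` is separable whenever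
`d(z) ≠ 0`: `F` is irreducible, hence separable, over `Frac B` (characteristic `0`), and a Bézout
relation `u F + v F' = 1` over `Frac B` clears to `U F + V F' = d` over `B`.
[Shafarevich1994 VII §2.3, Lemma (2) («unramified cover»)] [folklore] -/
theorem exists_separable (θ : A) :
    ∃ d : MvPolynomial (Fin r) ℂ, d ≠ 0 ∧ ∀ z : Fin r → ℂ, MvPolynomial.eval z d ≠ 0 →
      (spec (minpoly (MvPolynomial (Fin r) ℂ) θ) z).Separable := by
  classical
  let K := FractionRing (MvPolynomial (Fin r) ℂ)
  let L := FractionRing A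
  letI : Algebra K L := FractionRing.liftAlgebra (MvPolynomial (Fin r) ℂ) L
  haveI : IsScalarTower (MvPolynomial (Fin r) ℂ) K L :=
    FractionRing.isScalarTower_liftAlgebra _ _
  have hθ : IsIntegral (MvPolynomial (Fin r) ℂ) θ := Algebra.IsIntegral.isIntegral θ
  set F := minpoly (MvPolynomial (Fin r) ℂ) θ with hFdef
  have hFK : F.map (algebraMap _ K) = minpoly K (algebraMap A L θ) :=
    (minpoly.isIntegrallyClosed_eq_field_fractions K L hθ).symm
  have hθL : IsIntegral K (algebraMap A L θ) := (hθ.algebraMap (B := L)).tower_top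
  have hirr : Irreducible (F.map (algebraMap _ K)) := hFK ▸ minpoly.irreducible hθL
  have hsepK : (F.map (algebraMap _ K)).Separable := PerfectField.separable_of_irreducible hirr
  obtain ⟨u, v, huv⟩ := hsepK
  rw [Polynomial.derivative_map] at huv
  obtain ⟨du, hdu, hu⟩ :=
    IsLocalization.integerNormalization_spec (nonZeroDivisors (MvPolynomial (Fin r) ℂ)) u
  obtain ⟨dv, hdv, hv⟩ :=
    IsLocalization.integerNormalization_spec (nonZeroDivisors (MvPolynomial (Fin r) ℂ)) v
  set U := IsLocalization.integerNormalization (nonZeroDivisors (MvPolynomial (Fin r) ℂ)) u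
  set V := IsLocalization.integerNormalization (nonZeroDivisors (MvPolynomial (Fin r) ℂ)) v
  have hid : Polynomial.C dv * U * F + Polynomial.C du * V * Polynomial.derivative F =
      Polynomial.C (du * dv) := by
    apply Polynomial.map_injective (algebraMap _ K) (IsFractionRing.injective _ _)
    simp only [Polynomial.map_add, Polynomial.map_mul, Polynomial.map_C, hu, hv]
    rw [← algebraMap_smul K du u, ← algebraMap_smul K dv v, Polynomial.smul_eq_C_mul,
      Polynomial.smul_eq_C_mul, map_mul, Polynomial.C_mul]
    linear_combination
      (Polynomial.C (algebraMap _ K du) * Polynomial.C (algebraMap _ K dv)) * huv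
  refine ⟨du * dv, mul_ne_zero (nonZeroDivisors.ne_zero hdu) (nonZeroDivisors.ne_zero hdv),
    fun z hz ↦ ?_⟩
  have hz' := congrArg (Polynomial.map (MvPolynomial.eval z)) hid
  simp only [Polynomial.map_add, Polynomial.map_mul, Polynomial.map_C,
    ← Polynomial.derivative_map] at hz'
  rw [Polynomial.separable_def]
  refine ⟨Polynomial.C (MvPolynomial.eval z (du * dv))⁻¹ *
      (Polynomial.C (MvPolynomial.eval z dv) * U.map (MvPolynomial.eval z)),
    Polynomial.C (MvPolynomial.eval z (du * dv))⁻¹ *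
      (Polynomial.C (MvPolynomial.eval z du) * V.map (MvPolynomial.eval z)), ?_⟩
  have hC : Polynomial.C (MvPolynomial.eval z (du * dv))⁻¹ *
      Polynomial.C (MvPolynomial.eval z (du * dv)) = (1 : Polynomial ℂ) := by
    rw [← Polynomial.C_mul, inv_mul_cancel₀ hz, Polynomial.C_1]
  linear_combination (Polynomial.C (MvPolynomial.eval z (du * dv))⁻¹) * hz' + hC

end Noether

/-! ### Connectedness of `X` -/

include hq in
/-- **An irreducible affine variety over `ℂ` is connected in the classical topology**
(Shafarevich's Theorem 7.1, second proof, for `X = pts q`, `A` a domain finite over the Noether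
subring `B`). With `θ, c` from `exists_primitive`, `F` the minimal polynomial of `θ` and `d`
from `exists_separable`, put `g = c d`. The open part `X_g = {g ∘ π ≠ 0}` is the image of the
connected (`HypersurfaceCover.isConnected`) unramified hypersurface piece
`{(z, t) | g(z) ≠ 0, F(z, t) = 0}` under the continuous map `(z, t) ↦ (Pᵢ(z, t) / c(z))ᵢ`
(inverse to `x ↦ (π(x), θ(x))`; surjectivity onto `X_g` by `exists_mem_pts_over`), hence
connected; and `X_g` is dense in `X` (`subset_closure_setOf_eval_ne_zero`), so `X` is connected
(Corollary of §2.1). [cite: Shafarevich1994, Book 3 Ch. VII §2.3 (second proof of Thm. 7.1)]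
[cite: Mumford1981, (2.33)] -/
theorem isConnected_pts (s : ℕ) [Algebra (MvPolynomial (Fin s) ℂ) A]
    [IsScalarTower ℂ (MvPolynomial (Fin s) ℂ) A] [IsDomain A]
    [Algebra.IsIntegral (MvPolynomial (Fin s) ℂ) A] [FaithfulSMul (MvPolynomial (Fin s) ℂ) A] :
    IsConnected (pts q) := by
  classical
  obtain ⟨θ, c, hc, hPex⟩ := exists_primitive (r := s) q hq
  choose P hP using hPex
  obtain ⟨d, hd, hsep⟩ := exists_separable (A := A) (r := s) θ
  have hθ : IsIntegral (MvPolynomial (Fin s) ℂ) θ := Algebra.IsIntegral.isIntegral θ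
  set F := minpoly (MvPolynomial (Fin s) ℂ) θ with hFdef
  have hF : F.Monic := minpoly.monic hθ
  have hdeg : 0 < F.natDegree := minpoly.natDegree_pos hθ
  have hirr : ∀ Q₁ Q₂ : Polynomial (MvPolynomial (Fin s) ℂ), Q₁.Monic → Q₂.Monic → Q₁ * Q₂ = F →
      Q₁.natDegree = 0 ∨ Q₂.natDegree = 0 := fun Q₁ Q₂ _ _ h ↦ by
    rcases (minpoly.irreducible hθ).isUnit_or_isUnit h.symm with hu | hu
    · exact Or.inl (Polynomial.natDegree_eq_zero_of_isUnit hu)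
    · exact Or.inr (Polynomial.natDegree_eq_zero_of_isUnit hu)
  set g := c * d with hgdef
  have hg : g ≠ 0 := mul_ne_zero hc hd
  have hcg : ∀ z, MvPolynomial.eval z g ≠ 0 → MvPolynomial.eval z c ≠ 0 := fun z hz ↦ by
    rw [hgdef, map_mul] at hz
    exact left_ne_zero_of_mul hz
  have hsep' : ∀ z, MvPolynomial.eval z g ≠ 0 → (spec F z).Separable := fun z hz ↦
    hsep z (by rw [hgdef, map_mul] at hz; exact right_ne_zero_of_mul hz)
  have hU := HypersurfaceCover.isConnected hF hdeg hirr hg hsep'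
  -- the inverse map `Ψ (z, t) = (Pᵢ(z, t) / c(z))ᵢ`
  let Ψ : (Fin s → ℂ) × ℂ → (Fin n → ℂ) :=
    fun p i ↦ (spec (P i) p.1).eval p.2 / MvPolynomial.eval p.1 c
  have hΨcont : ContinuousOn Ψ
      {p : (Fin s → ℂ) × ℂ | MvPolynomial.eval p.1 g ≠ 0 ∧ (spec F p.1).eval p.2 = 0} := by
    refine continuousOn_pi.mpr fun i ↦ ContinuousOn.div ?_ ?_ fun p hp ↦ hcg _ hp.1
    · exact (HypersurfaceCover.contDiff_eval_spec (P i) (n := 0)).continuous.continuousOn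
    · exact ((MvPolynomial.continuous_eval c).comp continuous_fst).continuousOn
  have key : ∀ x ∈ pts q, MvPolynomial.eval (proj q hq x) c ≠ 0 →
      Ψ (proj q hq x, fn q hq θ x) = x := fun x hx hcx ↦ by
    funext i
    simp only [Ψ]
    rw [div_eq_iff hcx, ← fn_aeval q hq hx, hP i, fn_mul q hq hx, fn_algebraMap q hq hx,
      fn_q q hq hx, MvPolynomial.eval_X, mul_comm]
  have hXg : {x ∈ pts q | MvPolynomial.eval (proj (r := s) q hq x) g ≠ 0} =
      Ψ '' {p | MvPolynomial.eval p.1 g ≠ 0 ∧ (spec F p.1).eval p.2 = 0} := by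
    apply Set.Subset.antisymm
    · rintro x ⟨hx, hgx⟩
      exact ⟨(proj q hq x, fn q hq θ x), ⟨hgx, eval_spec_minpoly q hq hx θ⟩,
        key x hx (hcg _ hgx)⟩
    · rintro _ ⟨p, ⟨hgz, hzt⟩, rfl⟩
      obtain ⟨x, hx, hxz, hxt⟩ := exists_mem_pts_over (r := s) q hq θ hzt
      have hΨx : Ψ p = x := by
        have h1 := key x hx (by rw [hxz]; exact hcg _ hgz)
        rwa [hxz, hxt, Prod.mk.eta] at h1
      rw [hΨx]
      exact ⟨hx, by rw [hxz]; exact hgz⟩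
  have hconn : IsConnected {x ∈ pts q | MvPolynomial.eval (proj (r := s) q hq x) g ≠ 0} := by
    rw [hXg]
    exact hU.image Ψ hΨcont
  exact hconn.subset_closure (fun x hx ↦ hx.1) (subset_closure_setOf_eval_ne_zero q hq hg)


end ZeroLocusConnected

/-! ### The named fact -/

/-- **Irreducible affine varieties over `ℂ` are connected in the classical topology**: discharge
of the named fact `Literature.NumberTheory.Transcendental.isConnected_zeroLocus_of_isPrime` (Shafarevich's Theorem 7.1 in
coordinates; the irreducible affine case of SGA1 XII Prop. 2.4). For a prime `𝔭`, apply
`ZeroLocusConnected.isConnected_pts` to `A = ℂ[x₁, …, xₙ]/𝔭` with a Noether normalisation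
`ℂ[z₁, …, z_s] ↪ A` (Mathlib `exists_integral_inj_algHom_of_quotient`).
[cite: Shafarevich1994, Book 3 Ch. VII §2 Thm. 7.1] [cite: SGA1, Exp. XII Prop. 2.4]
[cite: Mumford1981, (2.33), (4.16)] -/
theorem isConnected_zeroLocus_of_isPrime_holds : isConnected_zeroLocus_of_isPrime := by
  intro n 𝔭 h𝔭
  classical
  have hq : Function.Surjective (Ideal.Quotient.mkₐ ℂ 𝔭) := Ideal.Quotient.mkₐ_surjective ℂ 𝔭
  have hpts : ZeroLocusConnected.pts (Ideal.Quotient.mkₐ ℂ 𝔭) = MvPolynomial.zeroLocus ℂ 𝔭 := by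
    ext x
    rw [ZeroLocusConnected.mem_pts, MvPolynomial.mem_zeroLocus_iff]
    refine forall_congr' fun p ↦ ?_
    rw [Ideal.Quotient.mkₐ_eq_mk, Ideal.Quotient.eq_zero_iff_mem, MvPolynomial.aeval_eq_eval]
  obtain ⟨s, -, φ, hφinj, hφint⟩ := exists_integral_inj_algHom_of_quotient 𝔭 h𝔭.ne_top
  letI : Algebra (MvPolynomial (Fin s) ℂ) (MvPolynomial (Fin n) ℂ ⧸ 𝔭) := φ.toRingHom.toAlgebra
  haveI : IsScalarTower ℂ (MvPolynomial (Fin s) ℂ) (MvPolynomial (Fin n) ℂ ⧸ 𝔭) :=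
    IsScalarTower.of_algebraMap_eq fun c ↦ (φ.commutes c).symm
  haveI : Algebra.IsIntegral (MvPolynomial (Fin s) ℂ) (MvPolynomial (Fin n) ℂ ⧸ 𝔭) :=
    ⟨fun a ↦ hφint a⟩
  haveI : FaithfulSMul (MvPolynomial (Fin s) ℂ) (MvPolynomial (Fin n) ℂ ⧸ 𝔭) :=
    (faithfulSMul_iff_algebraMap_injective _ _).mpr hφinj
  haveI : (𝔭 : Ideal (MvPolynomial (Fin n) ℂ)).IsPrime := h𝔭
  rw [← hpts]
  exact ZeroLocusConnected.isConnected_pts _ hq s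

/-! ### Shafarevich's Lemma 7.2 as printed -/

/-- **Shafarevich's Lemma 7.2** as printed («If `V ⊂ 𝔸ⁿ` is an open subset in the Zariski
topology then `V(ℂ)` is connected»), for `V ≠ ∅`: the complement of `V(I) ⊆ ℂⁿ`, `I ≠ 0` an ideal
of `ℂ[x₁, …, xₙ]`, is connected in the classical topology — it is the union of the principal
opens `D(g)`, `g ∈ I ∖ 0`, which are connected (`isConnected_setOf_eval_ne_zero`, the special
case proved in `ZeroLocusConnected.lean`) and pairwise meet (`D(g) ∩ D(h) = D(gh) ≠ ∅`).
[cite: Shafarevich1994, Book 3 Ch. VII §2.1 Lemma 7.2] -/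
theorem isConnected_compl_zeroLocus {n : ℕ} {I : Ideal (MvPolynomial (Fin n) ℂ)} (hI : I ≠ ⊥) :
    IsConnected (MvPolynomial.zeroLocus ℂ I : Set (Fin n → ℂ))ᶜ := by
  classical
  obtain ⟨g₀, hg₀I, hg₀⟩ := (Submodule.ne_bot_iff I).mp hI
  let ι : Type := {g : MvPolynomial (Fin n) ℂ // g ∈ I ∧ g ≠ 0}
  haveI : Nonempty ι := ⟨⟨g₀, hg₀I, hg₀⟩⟩
  have heval : ∀ (z : Fin n → ℂ) (g : MvPolynomial (Fin n) ℂ),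
      MvPolynomial.aeval z g = MvPolynomial.eval z g := fun z g ↦ by rw [MvPolynomial.aeval_eq_eval]
  have hcov : (MvPolynomial.zeroLocus ℂ I : Set (Fin n → ℂ))ᶜ =
      ⋃ g : ι, {z | MvPolynomial.eval z g.1 ≠ 0} := by
    ext z
    rw [Set.mem_compl_iff, MvPolynomial.mem_zeroLocus_iff, Set.mem_iUnion]
    constructor
    · intro hz
      simp only [not_forall] at hz
      obtain ⟨g, hg, hgz⟩ := hz
      rw [heval] at hgz
      have hg0 : g ≠ 0 := by
        rintro rfl
        exact hgz (map_zero _)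
      exact ⟨⟨g, hg, hg0⟩, hgz⟩
    · rintro ⟨g, hgz⟩ hz
      exact hgz ((heval z g.1) ▸ hz g.1 g.2.1)
  rw [hcov]
  refine IsConnected.iUnion_of_reflTransGen (fun g ↦ isConnected_setOf_eval_ne_zero g.2.2)
    fun g h ↦ Relation.ReflTransGen.single ?_
  obtain ⟨z, hz⟩ := exists_eval_ne_zero (mul_ne_zero g.2.2 h.2.2)
  rw [map_mul] at hz
  exact ⟨z, left_ne_zero_of_mul hz, right_ne_zero_of_mul hz⟩

end Literature.NumberTheory.Transcendental
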